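import Literature.Probability.LatticeModels.KCObservableBulkBounds
import Literature.Probability.LatticeModels.SlitPlaneSeamMatching
import HarnessLib

/-!
# Row gauges for the spin fermion with background spins: seam-free local sections and their bulk bounds

Topic `Literature/Probability/LatticeModels`. Chelkak–Hongler–Izyurov 2015 (Ann. of Math. 181),
Prop. 2.4: the spinor observable `F_{[Ω_δ,a;a_1,…,a_k]}` is an s-holomorphic SPINOR on the double
cover of `Ω_δ ∖ {a + δ/2}` branched at `a, a_1, …, a_k`. The tree realises it, for a background set
`B` of spins (`k = |B|`), by the signed section `kcObs G₂ Λ η B cut` (`IsingDisorderObservable.lean`),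
which is s-holomorphic at every upper corner and, at a lower corner `(y, SW)` / `(y, SE)`,
s-holomorphic when the two sign conventions agree there (`hLowSign = vLowSign`,
`isSHolAt_kcObs_two/three`) and ANTI-s-holomorphic (opposite projections, `IsAntiAt`) when they
disagree (`isAntiAt_kcObs_two/three`, `IsingDisorderSeam.lean`): the seams are the rightward
half-rows of lower corners issued from the source corner and from the background spins. The
regularity theory of `KCObservableBulkBounds.lean` (`KCBulk`, sup and Lipschitz bounds) is stated
for seam-free balls; for `B = ∅` the seam is crossed by the quadrant gauge of `SeamGauge.lean`.

This file gives the uniform device for every `B`: **row gauges**. Multiplying the section by a bond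
sign `σ(r)` depending only on the row `r` of the bond's base site (`rowChi σ`, `rowGauge σ F`)
preserves the relation at the upper corners and multiplies the relation at the two lower corners of
a site of row `r` by `σ(r-1)σ(r)`; so any pattern of seams which is constant along the rows of a
box is removed by a suitable `σ` (this is how a branch cut of a spinor is moved from one side of a
branch point to the other). Precisely:

* `rowChi`, `rowChi_east/north`, `rowGauge`, `norm_rowGauge` (the gauge does not change norms,
  hence neither `|F|²`-fluxes nor the primitive `H`);
* `isSHolAt_rowGauge_kcObs_zero/one` (always) and `isSHolAt_rowGauge_kcObs_two/three` under the
  sign conditions `hLowSign B (y-e₀) · vLowSign B cut (y-e₁) = σ(y₁-1)σ(y₁)` and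
  `vLowSign B cut (y-e₁) · hLowSign B y = σ(y₁-1)σ(y₁)` (the dichotomy s-holomorphic/anti of the
  section resolved by the dichotomy equal/opposite of the gauge);
* `KCBulkCore` (the bulk hypotheses of `KCBulk` without the seam clauses), `KCBulkGauge σ`
  (core + the two sign conditions), `KCBulkGauge.isSHolAt` (the gauged section is s-holomorphic at
  the four corners of every site whose west and south neighbours are in the set);
* **`norm_kcObs_le_of_gauge`**, **`norm_sub_rowGauge_kcObs_le_of_gauge`**: the sup bound
  `‖F‖ ≤ C(M)/√p` and the Lipschitz bound for the gauged section on gauged-bulk balls with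
  `|Hw|, |Hb| ≤ M` — the proofs of `norm_kcObs_le_of_bulk` / `norm_sub_kcObs_le_of_bulk` verbatim
  (the `L²` bound `sum_norm_sq_kcObs_le` is gauge-free, and the edge functions of the gauged
  section are lattice-harmonic by `isLatticeHarmonicOn_edgeFun_of_isSHolAt`).

Everything is proved; no named fact. Used by the section families with background spins
(CHI Thm 2.16 for `k ≥ 1`).

## References

* D. Chelkak, C. Hongler, K. Izyurov, Ann. of Math. 181 (2015) = arXiv:1202.2838: Prop. 2.4, §3.2
  (branch cuts), Thm 3.12 [ChelkakHonglerIzyurovAnnals2015].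
* S. Smirnov, Ann. of Math. 172 (2010): §5 [Smirnov2010].
-/

noncomputable section

namespace Literature.Probability.LatticeModels

open Finset Real SimpleGraph Complex

/-! ### Row gauges -/

open scoped Classical in
/-- **The row sign of a bond**: `σ(r)` for a bond based at a site of row `r` (east bond `{x, x+e₀}`
or north bond `{x, x+e₁}` of `x`, `r = x₁`); junk `1` on non-bonds. [cite: ChelkakHonglerIzyurovAnnals2015, §3.2 (branch cuts of the spinor)] -/
def rowChi (σ : ℤ → ℝ) (e : MedialVertex) : ℝ :=
  if h : ∃ v : Site 2, e = s(v, v + cornerUnit 0) then σ (h.choose 1)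
  else if h' : ∃ x : Site 2, e = s(x, x + cornerUnit 1) then σ (h'.choose 1) else 1

/-- The row sign of an east bond. [folklore] -/
theorem rowChi_east (σ : ℤ → ℝ) (v : Site 2) : rowChi σ s(v, v + cornerUnit 0) = σ (v 1) := by
  classical
  have h : ∃ u : Site 2, s(v, v + cornerUnit 0) = s(u, u + cornerUnit 0) := ⟨v, rfl⟩
  rw [rowChi, dif_pos h, eastBond_injective h.choose_spec.symm]

/-- The row sign of a north bond. [folklore] -/
theorem rowChi_north (σ : ℤ → ℝ) (x : Site 2) : rowChi σ s(x, x + cornerUnit 1) = σ (x 1) := by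
  classical
  have h : ¬ ∃ u : Site 2, s(x, x + cornerUnit 1) = s(u, u + cornerUnit 0) := fun ⟨u, hu⟩ => northBond_ne_eastBond x u hu
  have h' : ∃ u : Site 2, s(x, x + cornerUnit 1) = s(u, u + cornerUnit 1) := ⟨x, rfl⟩
  rw [rowChi, dif_neg h, dif_pos h', northBond_injective h'.choose_spec.symm]

/-- A row sign with values `±1` gives bond signs `±1`. [folklore] -/
theorem rowChi_cases {σ : ℤ → ℝ} (hσ : ∀ r, σ r = 1 ∨ σ r = -1) (e : MedialVertex) : rowChi σ e = 1 ∨ rowChi σ e = -1 := by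
  classical
  unfold rowChi
  split_ifs
  · exact hσ _
  · exact hσ _
  · exact Or.inl rfl

/-- **The row-gauged section** `(σ • F)(e) = σ(row of e) F(e)`. [cite: ChelkakHonglerIzyurovAnnals2015, §3.2] -/
def rowGauge (σ : ℤ → ℝ) (F : MedialVertex → ℂ) (e : MedialVertex) : ℂ := (rowChi σ e : ℂ) * F e

/-- The gauge does not change norms. [folklore] -/
theorem norm_rowGauge {σ : ℤ → ℝ} (hσ : ∀ r, σ r = 1 ∨ σ r = -1) (F : MedialVertex → ℂ) (e : MedialVertex) :
    ‖rowGauge σ F e‖ = ‖F e‖ := by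
  rw [rowGauge, norm_mul, Complex.norm_real, Real.norm_eq_abs]
  rcases rowChi_cases hσ e with h | h <;> rw [h] <;> simp

/-- The gauge does not change squares. [folklore] -/
theorem rowGauge_sq {σ : ℤ → ℝ} (hσ : ∀ r, σ r = 1 ∨ σ r = -1) (F : MedialVertex → ℂ) (e : MedialVertex) :
    rowGauge σ F e ^ 2 = F e ^ 2 := by
  rw [rowGauge, mul_pow]
  rcases rowChi_cases hσ e with h | h <;> rw [h] <;> push_cast <;> ring

/-! ### The row signs at the two bonds of each coded corner -/

/-- Corner `(y, NE)`: both bonds are based at `y`. [folklore] -/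
theorem rowChi_corner_zero (σ : ℤ → ℝ) (y : Site 2) :
    rowChi σ (cSrc (y, 0)) = σ (y 1) ∧ rowChi σ (cTgt (y, 0)) = σ (y 1) := by
  simp only [cSrc, cTgt, show (0 : Fin 4) + 1 = 1 from rfl, rowChi_east, rowChi_north, and_self]

/-- Corner `(y, NW)`: the north bond of `y` and the east bond of `y - e₀`, same row. [folklore] -/
theorem rowChi_corner_one (σ : ℤ → ℝ) (y : Site 2) :
    rowChi σ (cSrc (y, 1)) = σ (y 1) ∧ rowChi σ (cTgt (y, 1)) = σ (y 1) := by
  obtain ⟨-, -, -, wy1⟩ := westSite_facts y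
  simp only [cSrc, cTgt, show (1 : Fin 4) + 1 = 2 from rfl, westBond_eq, rowChi_east, rowChi_north, wy1, and_self]

/-- Corner `(y, SW)`: the east bond of `y - e₀` (row `y₁`) and the north bond of `y - e₁`
(row `y₁ - 1`). [folklore] -/
theorem rowChi_corner_two (σ : ℤ → ℝ) (y : Site 2) :
    rowChi σ (cSrc (y, 2)) = σ (y 1) ∧ rowChi σ (cTgt (y, 2)) = σ (y 1 - 1) := by
  obtain ⟨-, -, -, wy1⟩ := westSite_facts y
  obtain ⟨-, -, -, sy1⟩ := southSite_facts y
  simp only [cSrc, cTgt, show (2 : Fin 4) + 1 = 3 from rfl, westBond_eq, southBond_eq, rowChi_east, rowChi_north, wy1,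
    sy1, and_self]

/-- Corner `(y, SE)`: the north bond of `y - e₁` (row `y₁ - 1`) and the east bond of `y`
(row `y₁`). [folklore] -/
theorem rowChi_corner_three (σ : ℤ → ℝ) (y : Site 2) :
    rowChi σ (cSrc (y, 3)) = σ (y 1 - 1) ∧ rowChi σ (cTgt (y, 3)) = σ (y 1) := by
  obtain ⟨-, -, -, sy1⟩ := southSite_facts y
  simp only [cSrc, cTgt, show (3 : Fin 4) + 1 = 0 from rfl, southBond_eq, rowChi_east, rowChi_north, sy1, and_self]

/-- Sign arithmetic: for `a, b = ±1`, `ab = 1 ⇒ a = b` and `ab = -1 ⇒ a = -b`. [folklore] -/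
theorem pm_eq_of_mul_eq {a b : ℝ} (ha : a = 1 ∨ a = -1) (hb : b = 1 ∨ b = -1) :
    (a * b = 1 → a = b) ∧ (a * b = -1 → a = -b) := by
  rcases ha with rfl | rfl <;> rcases hb with rfl | rfl <;> norm_num

/-! ### The gauged section at the four corner types -/

section Corners

variable (G₂ : SimpleGraph (Site 2)) [G₂.LocallyFinite]
variable {Λ : Finset (Site 2)} {η : SpinConfig (Site 2)} {B : Finset (Site 2)} {cut : Site 2 → Finset (Sym2 (Site 2))}
variable {σ : ℤ → ℝ}

/-- **Upper corner `(y, NE)`**: the gauged section is s-holomorphic (equal signs on the two bonds). [cite: ChelkakHonglerIzyurovAnnals2015, Prop. 2.4] -/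
theorem isSHolAt_rowGauge_kcObs_zero (hσ : ∀ r, σ r = 1 ∨ σ r = -1)
    (hG : ∀ v ∈ Λ, ∀ k : Fin 4, G₂.Adj v (v + cornerUnit k)) (hle : G₂ ≤ zdGraph 2)
    {y : Site 2} (hT : cut (faceAt y 1) ⊆ edgesTouching G₂ Λ) (he : s(y, y + cornerUnit 1) ∈ edgesTouching G₂ Λ)
    (hstep : KCGaugeEquiv G₂ Λ (symmDiff (cut (faceAt y 1)) {s(y, y + cornerUnit 1)}) (cut (faceAt y 0))) :
    IsSHolAt (rowGauge σ (kcObs G₂ Λ η B cut)) (y, 0) := by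
  obtain ⟨h1, h2⟩ := rowChi_corner_zero σ y
  exact (isSHolAt_sign_mul_iff (χ := rowChi σ) (by rw [h1]; exact hσ _) (by rw [h1, h2])).2
    (isSHolAt_kcObs_zero G₂ hG hle hT he hstep)

/-- **Upper corner `(y, NW)`**: the gauged section is s-holomorphic. [cite: ChelkakHonglerIzyurovAnnals2015, Prop. 2.4] -/
theorem isSHolAt_rowGauge_kcObs_one (hσ : ∀ r, σ r = 1 ∨ σ r = -1)
    (hG : ∀ v ∈ Λ, ∀ k : Fin 4, G₂.Adj v (v + cornerUnit k)) (hle : G₂ ≤ zdGraph 2)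
    {y : Site 2} (hT : cut (faceAt y 1) ⊆ edgesTouching G₂ Λ)
    (he : s(y + cornerUnit 2, y + cornerUnit 2 + cornerUnit 0) ∈ edgesTouching G₂ Λ)
    (hstep : KCGaugeEquiv G₂ Λ (symmDiff (cut (faceAt y 1)) {s(y + cornerUnit 2, y + cornerUnit 2 + cornerUnit 0)})
      (cut (faceAt y 2))) :
    IsSHolAt (rowGauge σ (kcObs G₂ Λ η B cut)) (y, 1) := by
  obtain ⟨h1, h2⟩ := rowChi_corner_one σ y
  exact (isSHolAt_sign_mul_iff (χ := rowChi σ) (by rw [h1]; exact hσ _) (by rw [h1, h2])).2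
    (isSHolAt_kcObs_one G₂ hG hle hT he hstep)

/-- **Lower corner `(y, SW)`**: the gauged section is s-holomorphic when
`hLowSign (y - e₀) · vLowSign (y - e₁) = σ(y₁ - 1) σ(y₁)` (the section is s-holomorphic there and the
signs of the two bonds agree, or the section is anti there and the signs differ). [cite: ChelkakHonglerIzyurovAnnals2015, Prop. 2.4 and §3.2] -/
theorem isSHolAt_rowGauge_kcObs_two (hσ : ∀ r, σ r = 1 ∨ σ r = -1)
    (hG : ∀ v ∈ Λ, ∀ k : Fin 4, G₂.Adj v (v + cornerUnit k)) (hle : G₂ ≤ zdGraph 2)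
    {y : Site 2} (hT : cut (faceAt y 2) ⊆ edgesTouching G₂ Λ)
    (he : s(y + cornerUnit 3, y + cornerUnit 3 + cornerUnit 1) ∈ edgesTouching G₂ Λ)
    (hstep : KCGaugeEquiv G₂ Λ (symmDiff (cut (faceAt y 2)) {s(y + cornerUnit 3, y + cornerUnit 3 + cornerUnit 1)})
      (cut (faceAt y 3)))
    (hsign : hLowSign B (y + cornerUnit 2) * vLowSign B cut (y + cornerUnit 3) = σ (y 1 - 1) * σ (y 1)) :
    IsSHolAt (rowGauge σ (kcObs G₂ Λ η B cut)) (y, 2) := by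
  obtain ⟨h1, h2⟩ := rowChi_corner_two σ y
  have hχ : rowChi σ (cSrc (y, 2)) = 1 ∨ rowChi σ (cSrc (y, 2)) = -1 := by rw [h1]; exact hσ _
  have hhv := pm_eq_of_mul_eq (hLowSign_cases B (y + cornerUnit 2)) (vLowSign_cases B cut (y + cornerUnit 3))
  have hss := pm_eq_of_mul_eq (hσ (y 1 - 1)) (hσ (y 1))
  rcases pm_mul (hσ (y 1 - 1)) (hσ (y 1)) with hp | hp
  · -- equal signs: the section is s-holomorphic at the corner
    have heq : rowChi σ (cTgt (y, 2)) = rowChi σ (cSrc (y, 2)) := by rw [h1, h2, hss.1 hp]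
    exact (isSHolAt_sign_mul_iff (χ := rowChi σ) hχ heq).2
      (isSHolAt_kcObs_two G₂ hG hle hT he hstep (hhv.1 (hsign.trans hp)))
  · -- opposite signs: the section is anti at the corner
    have hop : rowChi σ (cTgt (y, 2)) = -rowChi σ (cSrc (y, 2)) := by rw [h1, h2, hss.2 hp]
    exact ((isSHolAt_sign_mul_iff_anti (χ := rowChi σ) hχ hop).1).2
      (isAntiAt_kcObs_two G₂ hG hle hT he hstep (hhv.2 (hsign.trans hp)))

/-- **Lower corner `(y, SE)`**: the gauged section is s-holomorphic when
`vLowSign (y - e₁) · hLowSign y = σ(y₁ - 1) σ(y₁)`. [cite: ChelkakHonglerIzyurovAnnals2015, Prop. 2.4 and §3.2] -/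
theorem isSHolAt_rowGauge_kcObs_three (hσ : ∀ r, σ r = 1 ∨ σ r = -1)
    (hG : ∀ v ∈ Λ, ∀ k : Fin 4, G₂.Adj v (v + cornerUnit k)) (hle : G₂ ≤ zdGraph 2)
    {y : Site 2} (hT : cut (faceAt y 0) ⊆ edgesTouching G₂ Λ) (he : s(y, y + cornerUnit 0) ∈ edgesTouching G₂ Λ)
    (hstep : KCGaugeEquiv G₂ Λ (symmDiff (cut (faceAt y 0)) {s(y, y + cornerUnit 0)}) (cut (faceAt y 3)))
    (hsign : vLowSign B cut (y + cornerUnit 3) * hLowSign B y = σ (y 1 - 1) * σ (y 1)) :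
    IsSHolAt (rowGauge σ (kcObs G₂ Λ η B cut)) (y, 3) := by
  obtain ⟨h1, h2⟩ := rowChi_corner_three σ y
  have hχ : rowChi σ (cSrc (y, 3)) = 1 ∨ rowChi σ (cSrc (y, 3)) = -1 := by rw [h1]; exact hσ _
  have hhv := pm_eq_of_mul_eq (vLowSign_cases B cut (y + cornerUnit 3)) (hLowSign_cases B y)
  have hss := pm_eq_of_mul_eq (hσ (y 1 - 1)) (hσ (y 1))
  rcases pm_mul (hσ (y 1 - 1)) (hσ (y 1)) with hp | hp
  · have heq : rowChi σ (cTgt (y, 3)) = rowChi σ (cSrc (y, 3)) := by rw [h1, h2, hss.1 hp]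
    exact (isSHolAt_sign_mul_iff (χ := rowChi σ) hχ heq).2
      (isSHolAt_kcObs_three G₂ hG hle hT he hstep (hhv.1 (hsign.trans hp)))
  · have hop : rowChi σ (cTgt (y, 3)) = -rowChi σ (cSrc (y, 3)) := by
      rw [h1, h2, hss.2 hp]; rcases hσ (y 1) with h | h <;> rw [h] <;> norm_num
    exact ((isSHolAt_sign_mul_iff_anti (χ := rowChi σ) hχ hop).1).2
      (isAntiAt_kcObs_three G₂ hG hle hT he hstep (hhv.2 (hsign.trans hp)))

end Corners

/-! ### Gauged bulk hypotheses and the bulk bounds for the gauged section -/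

section Bulk

variable (G₂ : SimpleGraph (Site 2)) [G₂.LocallyFinite]

/-- **Core bulk hypotheses** on a finite set `S` of sites (those of `KCBulk` without the seam
clauses): free sites off the background set whose four bonds are their edge boundary in the domain
graph, plaquettes in the cut system with touching sides and odd cut parity. [cite: ChelkakHonglerIzyurovAnnals2015, §3.3] -/
structure KCBulkCore (Λ : Finset (Site 2)) (B : Finset (Site 2)) (cut : Site 2 → Finset (Sym2 (Site 2))) (P : Set (Site 2))
    (S : Finset (Site 2)) : Prop where
  mem : ∀ x ∈ S, x ∈ Λ
  notMem : ∀ x ∈ S, x ∉ B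
  bd : ∀ x ∈ S, edgeBoundary G₂ {x} = Finset.univ.image fun k : Fin 4 => cSrc (x, k)
  faces : ∀ x ∈ S, ∀ k : Fin 4, faceAt x k ∈ P
  sides : ∀ f ∈ S, ∀ j : Fin 4, s(f + cornerOff j, f + cornerOff j + cornerUnit j) ∈ edgesTouching G₂ Λ
  odd : ∀ f ∈ S, Odd #(Finset.univ.filter fun j : Fin 4 => s(f + cornerOff j, f + cornerOff j + cornerUnit j) ∈ cut f)

/-- **Gauged bulk hypotheses** for the row sign `σ`: the core hypotheses and, at every site of `S`,
the two sign conditions under which the `σ`-gauged section is s-holomorphic at the lower corners. [cite: ChelkakHonglerIzyurovAnnals2015, Prop. 2.4 and §3.2] -/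
structure KCBulkGauge (Λ : Finset (Site 2)) (B : Finset (Site 2)) (cut : Site 2 → Finset (Sym2 (Site 2))) (P : Set (Site 2))
    (σ : ℤ → ℝ) (S : Finset (Site 2)) : Prop extends KCBulkCore G₂ Λ B cut P S where
  sgn₂ : ∀ y ∈ S, hLowSign B (y + cornerUnit 2) * vLowSign B cut (y + cornerUnit 3) = σ (y 1 - 1) * σ (y 1)
  sgn₃ : ∀ y ∈ S, vLowSign B cut (y + cornerUnit 3) * hLowSign B y = σ (y 1 - 1) * σ (y 1)

variable {G₂}
variable {Λ : Finset (Site 2)} {η : SpinConfig (Site 2)} {B : Finset (Site 2)} {cut : Site 2 → Finset (Sym2 (Site 2))}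
  {P : Set (Site 2)} {σ : ℤ → ℝ}

/-- Restriction of the core hypotheses to a subset. [folklore] -/
theorem KCBulkCore.mono {S S' : Finset (Site 2)} (h : KCBulkCore G₂ Λ B cut P S) (hS : S' ⊆ S) : KCBulkCore G₂ Λ B cut P S' :=
  ⟨fun x hx => h.mem x (hS hx), fun x hx => h.notMem x (hS hx), fun x hx => h.bd x (hS hx), fun x hx => h.faces x (hS hx),
    fun f hf => h.sides f (hS hf), fun f hf => h.odd f (hS hf)⟩

/-- Restriction of the gauged hypotheses to a subset. [folklore] -/
theorem KCBulkGauge.mono {S S' : Finset (Site 2)} (h : KCBulkGauge G₂ Λ B cut P σ S) (hS : S' ⊆ S) :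
    KCBulkGauge G₂ Λ B cut P σ S' :=
  ⟨h.toKCBulkCore.mono hS, fun y hy => h.sgn₂ y (hS hy), fun y hy => h.sgn₃ y (hS hy)⟩

/-- The seam-free bulk hypotheses are the gauged ones for the trivial row sign `σ ≡ 1`. [folklore] -/
theorem KCBulk.gauge_one {S : Finset (Site 2)} (h : KCBulk G₂ Λ B cut P S) : KCBulkGauge G₂ Λ B cut P (fun _ => 1) S := by
  refine ⟨⟨h.mem, h.notMem, h.bd, h.faces, h.sides, h.odd⟩, fun y hy => ?_, fun y hy => ?_⟩
  · rw [h.seam₂ y hy, one_mul]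
    rcases vLowSign_cases B cut (y + cornerUnit 3) with h1 | h1 <;> rw [h1] <;> norm_num
  · rw [h.seam₃ y hy, one_mul]
    rcases hLowSign_cases B y with h1 | h1 <;> rw [h1] <;> norm_num

/-- **The gauged section is s-holomorphic at the four corners of a gauged-bulk site** whose west and
south neighbours are gauged-bulk sites too. [cite: ChelkakHonglerIzyurovAnnals2015, Prop. 2.4] -/
theorem KCBulkGauge.isSHolAt {S : Finset (Site 2)} (h : KCBulkGauge G₂ Λ B cut P σ S) (hσ : ∀ r, σ r = 1 ∨ σ r = -1)
    (hc : IsKCCuts G₂ Λ cut P) (hG : ∀ v ∈ Λ, ∀ k : Fin 4, G₂.Adj v (v + cornerUnit k)) (hle : G₂ ≤ zdGraph 2)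
    {y : Site 2} (hy : y ∈ S) (hyW : y + cornerUnit 2 ∈ S) (hyS : y + cornerUnit 3 ∈ S) (k : Fin 4) :
    IsSHolAt (rowGauge σ (kcObs G₂ Λ η B cut)) (y, k) := by
  obtain ⟨w0, wf0, wf3, -⟩ := westSite_facts y
  obtain ⟨s0, sf1, sf0, -⟩ := southSite_facts y
  have hP := h.faces y hy
  fin_cases k
  · obtain ⟨he, hstep⟩ := hc.step_gaugeEquiv G₂ (h.mem y hy) 1 (hP 1) (by rw [show (1 : Fin 4) + 3 = 0 from rfl]; exact hP 0)
    rw [show (1 : Fin 4) + 3 = 0 from rfl] at hstep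
    exact isSHolAt_rowGauge_kcObs_zero G₂ hσ hG hle (hc.subset _ (hP 1)) he hstep
  · have h1 : faceAt (y + cornerUnit 2) 0 ∈ P := by rw [wf0]; exact hP 1
    have h2 : faceAt (y + cornerUnit 2) (0 + 3) ∈ P := by rw [show (0 : Fin 4) + 3 = 3 from rfl, wf3]; exact hP 2
    obtain ⟨he, hstep⟩ := hc.step_gaugeEquiv G₂ (h.mem _ hyW) 0 h1 h2
    rw [show (0 : Fin 4) + 3 = 3 from rfl, wf0, wf3] at hstep
    simp only [cSrc] at he hstep
    exact isSHolAt_rowGauge_kcObs_one G₂ hσ hG hle (hc.subset _ (hP 1)) he hstep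
  · have h1 : faceAt (y + cornerUnit 3) 1 ∈ P := by rw [sf1]; exact hP 2
    have h2 : faceAt (y + cornerUnit 3) (1 + 3) ∈ P := by rw [show (1 : Fin 4) + 3 = 0 from rfl, sf0]; exact hP 3
    obtain ⟨he, hstep⟩ := hc.step_gaugeEquiv G₂ (h.mem _ hyS) 1 h1 h2
    rw [show (1 : Fin 4) + 3 = 0 from rfl, sf1, sf0] at hstep
    simp only [cSrc] at he hstep
    exact isSHolAt_rowGauge_kcObs_two G₂ hσ hG hle (hc.subset _ (hP 2)) he hstep (h.sgn₂ y hy)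
  · obtain ⟨he, hstep⟩ := hc.step_gaugeEquiv G₂ (h.mem y hy) 0 (hP 0) (by rw [show (0 : Fin 4) + 3 = 3 from rfl]; exact hP 3)
    rw [show (0 : Fin 4) + 3 = 3 from rfl] at hstep
    exact isSHolAt_rowGauge_kcObs_three G₂ hσ hG hle (hc.subset _ (hP 0)) he hstep (h.sgn₃ y hy)

/-- **Sup bound for the spin fermion on a gauged-bulk ball**: with `m = 4p`, `p ≥ 8`, if the ball
of radius `4m + 3` about the centre of the box of side `4m` at `a` is gauged bulk for some row sign
`σ = ±1` and `|Hw|, |Hb| ≤ M` on the ball of radius `4m + 1` for a Kadanoff–Ceva primitive, then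
`‖F(e)‖ ≤ C(M)/√p` for the horizontal and vertical edges at the sites of the ball of radius `p`
(the norm of the section is gauge-free). [cite: ChelkakHonglerIzyurovAnnals2015, Thm 3.12 (uniform boundedness (3.12))] -/
theorem norm_kcObs_le_of_gauge {Hw Hb : Site 2 → ℝ} (h : IsKCPrimitive G₂ Λ criticalBetaTwo (.fixed η) B cut Hw Hb P)
    (hc : IsKCCuts G₂ Λ cut P) (hG : ∀ v ∈ Λ, ∀ k : Fin 4, G₂.Adj v (v + cornerUnit k)) (hle : G₂ ≤ zdGraph 2)
    (hσ : ∀ r, σ r = 1 ∨ σ r = -1) {a : Site 2} {p : ℕ} (hp : 8 ≤ p)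
    (hbulk : KCBulkGauge G₂ Λ B cut P σ (latticeBall (boxCentre a (4 * p)) (2 * (2 * (4 * p)) + 3)))
    {M : ℝ} (hM : 0 < M)
    (hHw : ∀ x ∈ latticeBall (boxCentre a (4 * p)) (2 * (2 * (4 * p)) + 1), |Hw x| ≤ M)
    (hHb : ∀ x ∈ latticeBall (boxCentre a (4 * p)) (2 * (2 * (4 * p)) + 1), |Hb x| ≤ M)
    {x : Site 2} (hx : x ∈ latticeBall (boxCentre a (4 * p)) p) {i : Fin 4} (hi : i = 0 ∨ i = 1) :
    ‖kcObs G₂ Λ η B cut (cSrc (x, i))‖ ≤ kcSupConst M / Real.sqrt p := by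
  set m := 4 * p with hm
  set c := boxCentre a m with hc0
  set Gσ := rowGauge σ (kcObs G₂ Λ η B cut) with hGσ
  have hm4 : 4 ≤ m := by omega
  have hsub : ∀ {R R' : ℤ}, R ≤ R' → ∀ y ∈ latticeBall c R, y ∈ latticeBall c R' :=
    fun hRR' y hy => latticeBall_subset hRR' hy
  -- the `L²` bound on the ball of radius `m` (gauge-free)
  have hL2 := sum_norm_sq_kcObs_le G₂ h hc hG hle hm4 hbulk.mem hbulk.notMem hbulk.bd hbulk.faces hbulk.sides hbulk.odd hM hHw hHb
  -- s-holomorphicity of the gauged section at all corners of the sites of the ball of radius `4m + 2`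
  have hS : ∀ y ∈ latticeBall c (2 * (2 * m) + 2), ∀ k : Fin 4, IsSHolAt Gσ (y, k) := by
    intro y hy k
    exact hbulk.isSHolAt hσ hc hG hle (hsub (by omega) y hy) (hsub (by omega) _ (add_cornerUnit_mem_latticeBall hy 2))
      (hsub (by omega) _ (add_cornerUnit_mem_latticeBall hy 3)) k
  have hharm := isLatticeHarmonicOn_edgeFun_of_isSHolAt (G := Gσ) (c := c) (R := 2 * (2 * m)) hS i hi
  set K : ℝ := 4 * Real.sqrt 2 * kcFluxConst * M * energyGradConst with hK
  have hK0 : 0 ≤ K := by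
    have := kcFluxConst_pos; have := energyGradConst_pos; positivity
  have hL2i : ∑ y ∈ latticeBall c m, ‖edgeFun Gσ i y‖ ^ 2 ≤ K * (m : ℕ) := by
    refine le_trans (Finset.sum_le_sum fun y _ => ?_) (le_of_le_of_eq hL2 (by rw [hK]; ring))
    simp only [edgeFun, hGσ, norm_rowGauge hσ]
    rcases hi with rfl | rfl
    · exact le_add_of_nonneg_right (sq_nonneg _)
    · exact le_add_of_nonneg_left (sq_nonneg _)
  have key := norm_le_of_harmonic_of_sum_sq_le (g := edgeFun Gσ i) (a := a) hp hharm.1 hharm.2 hK0 hL2i hx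
  rw [edgeFun, hGσ, norm_rowGauge hσ] at key
  simpa [kcSupConst, hK] using key

/-- **Lipschitz bound for the gauged section on a gauged-bulk ball**: with `m = 8q`, `q ≥ 8`, under
the gauged bulk hypotheses on the ball of radius `4m + 3` and `|Hw|, |Hb| ≤ M` on the ball of radius
`4m + 1`, `‖(σ•F)(x + e_j, ·) - (σ•F)(x, ·)‖ ≤ 8 C_top C(M) / (2q √(2q))` for the edge functions of the
GAUGED section at the sites of the ball of radius `q`. [cite: ChelkakHonglerIzyurovAnnals2015, Thm 3.12 (equicontinuity (3.13))] -/
theorem norm_sub_rowGauge_kcObs_le_of_gauge {Hw Hb : Site 2 → ℝ} (h : IsKCPrimitive G₂ Λ criticalBetaTwo (.fixed η) B cut Hw Hb P)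
    (hc : IsKCCuts G₂ Λ cut P) (hG : ∀ v ∈ Λ, ∀ k : Fin 4, G₂.Adj v (v + cornerUnit k)) (hle : G₂ ≤ zdGraph 2)
    (hσ : ∀ r, σ r = 1 ∨ σ r = -1) {a : Site 2} {q : ℕ} (hq : 8 ≤ q)
    (hbulk : KCBulkGauge G₂ Λ B cut P σ (latticeBall (boxCentre a (4 * (2 * q))) (2 * (2 * (4 * (2 * q))) + 3)))
    {M : ℝ} (hM : 0 < M)
    (hHw : ∀ x ∈ latticeBall (boxCentre a (4 * (2 * q))) (2 * (2 * (4 * (2 * q))) + 1), |Hw x| ≤ M)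
    (hHb : ∀ x ∈ latticeBall (boxCentre a (4 * (2 * q))) (2 * (2 * (4 * (2 * q))) + 1), |Hb x| ≤ M)
    {x : Site 2} (hx : x ∈ latticeBall (boxCentre a (4 * (2 * q))) q) {i : Fin 4} (hi : i = 0 ∨ i = 1) (j : Fin 4) :
    ‖rowGauge σ (kcObs G₂ Λ η B cut) (cSrc (x + cornerUnit j, i)) - rowGauge σ (kcObs G₂ Λ η B cut) (cSrc (x, i))‖ ≤
      8 * topGradConst * (kcSupConst M / Real.sqrt (2 * q : ℕ)) / (2 * q : ℕ) := by
  set p := 2 * q with hp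
  set m := 4 * p with hm
  set c := boxCentre a m with hc0
  set Gσ := rowGauge σ (kcObs G₂ Λ η B cut) with hGσ
  have hp8 : 8 ≤ p := by omega
  have hsub : ∀ {R R' : ℤ}, R ≤ R' → ∀ y ∈ latticeBall c R, y ∈ latticeBall c R' :=
    fun hRR' y hy => latticeBall_subset hRR' hy
  have hsup : ∀ y ∈ latticeBall c p, ‖edgeFun Gσ i y‖ ≤ kcSupConst M / Real.sqrt p := fun y hy => by
    rw [edgeFun, hGσ, norm_rowGauge hσ]
    exact norm_kcObs_le_of_gauge h hc hG hle hσ hp8 hbulk hM hHw hHb hy hi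
  have hS : ∀ y ∈ latticeBall c (2 * (2 * m) + 2), ∀ k : Fin 4, IsSHolAt Gσ (y, k) := by
    intro y hy k
    exact hbulk.isSHolAt hσ hc hG hle (hsub (by omega) y hy) (hsub (by omega) _ (add_cornerUnit_mem_latticeBall hy 2))
      (hsub (by omega) _ (add_cornerUnit_mem_latticeBall hy 3)) k
  have hharm := isLatticeHarmonicOn_edgeFun_of_isSHolAt (G := Gσ) (c := c) (R := 2 * (2 * m)) hS i hi
  have hM0 : 0 ≤ kcSupConst M / Real.sqrt p := div_nonneg (kcSupConst_nonneg M) (Real.sqrt_nonneg _)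
  have key := norm_sub_le_of_harmonic_of_norm_le (g := edgeFun Gσ i) (a := a) hq hharm.1 hharm.2 hM0
    (fun y hy => hsup y (by simpa [hp] using hy)) hx j
  simpa [edgeFun, hp] using key

end Bulk

end Literature.Probability.LatticeModels
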